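import Literature.NumberTheory.EllipticCurves.BSDSelmerSmithNoRationalTwoTorsionProofs
import Literature.NumberTheory.EllipticCurves.ComplexMultiplicationTwistIsogenyProofs
import HarnessLib

/-!
# `E(ℚ)[2] = 0` in coefficients: models with `a₃` odd, the curves `y² = x³ + k`, and Smith's law
# for the class-number-one CM curves with `2` inert from [Smi22a] part I

A `…Proofs` companion (theorems only; no definitions, no named facts) of
`BSDSelmerSmithNoRationalTwoTorsionProofs` (`#E(ℚ)[2] = 1` iff the `2`-division cubic
`4x³ + b₂x² + 2b₄x + b₆` has no rational root; Smith's law `smith_selmerCorank_density` for such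
curves from [Smi22a] Thm. 1.2, branch (1) of Assumption 1.1) and of
`ComplexMultiplicationTwistIsogenyProofs` (the minimal CM models `cm11, cm19, cm43, cm67, cm163` of
Silverman, *Advanced Topics*, App. A §3).

* §4 **Parity criterion.** For integers `A, B, C` with `C` odd, `4x³ + 4Ax² + 4Bx + C` has no
  rational root (`cubic_ne_zero_of_odd`: in lowest terms `x = p/q`, the equation
  `4p³ + 4Ap²q + 4Bpq² + Cq³ = 0` forces `q` even, then `p` even). Hence **every model
  `y² + a₃y = x³ + a₂x² + a₄x + a₆` with `a₂, a₄, a₆ ∈ ℤ` and `a₃` odd has `E(ℚ)[2] = 0`**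
  (`ratTwoTorsionCard_eq_one_of_odd_a₃`; its cubic is `4x³ + 4a₂x² + 4a₄x + (a₃² + 4a₆)`), and
  Smith's law holds for it by [Smi22a] Thm. 1.2 (`smith_selmerCorank_density_of_odd_a₃`). Also:
  `y² = x³ + k` (`k ≠ 0`) has `E(ℚ)[2] = 0` iff `-k ∉ ℚ³` (`ratTwoTorsionCard_j_zero_model_eq_one_iff`).
* §5 **The CM curves `cm11 = 121b1`, `cm19 = 361a1`, `cm43`, `cm67`, `cm163`** (CM by `𝒪_K`,
  `K = ℚ(√-11), …, ℚ(√-163)`: the class-number-one fields with `2` inert other than `ℚ(√-3)`) all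
  have `a₁ = 0`, `a₃ = 1`, so `E(ℚ)[2] = 0` (`ratTwoTorsionCard_cm11`, …); by §2 of the sibling
  file the same holds for **every** elliptic `W/ℚ` with one of these five `j`-invariants
  (`ratTwoTorsionCard_eq_one_of_j_mem`), and **Smith's `2^∞`-Selmer corank law for all of them
  follows from the refereed part I alone** (`smith_selmerCorank_density_of_j_mem_of_smith2022`;
  provenance of the instance — branch (1) of [Smi22a] Assumption 1.1 is proved in part I — while
  the formal hypothesis is the one named fact `h22 = smith2022_selmerCorank_distribution` =
  [Smi22a] Thm. 1.2 as stated for all three branches, cf. the GAP-C note in the sibling file) —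
  the `2`-inert companion of `smith_selmerCorank_density_cm7_of_smith2022` (`X₀(49)`, `2` split,
  branch (2), which needs part II). For `ℚ(√-3)`: the conductor-`27` curves
  `27a1 : y² + y = x³ - 7`, `27a3 : y² + y = x³` (`j = 0`) are covered by the same parity criterion
  (`ratTwoTorsionCard_conductor27`), and so is `27a4 : y² + y = x³ - 30x + 63` (`j = -12288000`,
  CM by `ℤ[3ω]`), whence `E(ℚ)[2] = 0` and Smith's law for EVERY curve with `j = -12288000`
  (`ratTwoTorsionCard_eq_one_of_j_eq_neg12288000`,
  `smith_selmerCorank_density_of_j_eq_neg12288000_of_smith2022`); the `j = 0` curves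
  `y² = x³ + k` depend on `k` (`E(ℚ)[2] = 0` iff `-k ∉ ℚ³`, §4).

Motivation: cell `bsd-goldfeld`, variant (α) of the brief (CM field with `2` inert): the Smith
input `hS : smith_selmerCorank_density E₀` of the even-parity Goldfeld assembly
(`Summits/BirchSwinnertonDyer/…/GoldfeldGoodTwists*.lean`) is thereby discharged from the refereed
named fact `smith2022_selmerCorank_distribution` for these `E₀` too.

## References

* [Smith2022SelmerTwistI] A. Smith, J. Amer. Math. Soc. 39 (2026), no. 1, 1–72
  (arXiv:2207.05674): Assumption 1.1 (1), Thm. 1.2, Thm. 1.5 (arXiv p. 3–4).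
* [SilvermanATAEC1994] J. H. Silverman, *Advanced Topics in the Arithmetic of Elliptic Curves*,
  App. A §3 (the thirteen CM `j`-invariants and minimal models over `ℚ`).
* [SilvermanAEC2009] J. H. Silverman, *AEC*, 2nd ed.: III.1, III.2.3, Exercise 3.7, X.5.4.
* [SilvermanTate2015] J. H. Silverman, J. T. Tate, *Rational Points on Elliptic Curves*, 2nd ed.,
  §2.1, Thm. 2.1(a).
* [Cremona2006] J. E. Cremona, *The Elliptic Curve Database for Conductors to 130000*, ANTS-VII
  (2006): Cremona labels `27a1`, `27a3`, `27a4`, `121b1`, `361a1`, `1849a1`, `4489a1`, `26569a1`.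
-/

noncomputable section

open scoped Classical

namespace Literature.NumberTheory.EllipticCurves

open WeierstrassCurve

/-! ## §4 Two families in coefficients: `a₁ = 0`, `a₃` odd, `aᵢ ∈ ℤ`; and `y² = x³ + k` -/

section Integral

/-- **Parity lemma.** For integers `A, B, C` with `C` odd, `4x³ + 4Ax² + 4Bx + C` has no rational
root: writing `x = p/q` in lowest terms, `4p³ + 4Ap²q + 4Bpq² + Cq³ = 0` forces `q` even (the
other three terms are even and `C` is odd), and then `p³ = -2(Ap²q' + 2Bpq'² + Cq'³)` (`q = 2q'`)
forces `p` even — contradicting `gcd(p, q) = 1`. [folklore] -/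
private theorem cubic_ne_zero_of_odd (A B C : ℤ) (hC : Odd C) (x : ℚ) :
    4 * x ^ 3 + 4 * A * x ^ 2 + 4 * B * x + C ≠ 0 := by
  intro hx
  set p : ℤ := x.num with hp_def
  set q : ℕ := x.den with hq_def
  have hq0 : (q : ℚ) ≠ 0 := by exact_mod_cast x.den_nz
  have hxq : x = p / q := (Rat.num_div_den x).symm
  have hp : (p : ℚ) = x * (q : ℚ) := by rw [hxq, div_mul_cancel₀ _ hq0]
  -- the integer equation
  have h' : ((4 * p ^ 3 + 4 * A * p ^ 2 * q + 4 * B * p * q ^ 2 + C * q ^ 3 : ℤ) : ℚ) = 0 := by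
    push_cast
    rw [hp]
    linear_combination (q : ℚ) ^ 3 * hx
  have hZ : 4 * p ^ 3 + 4 * A * p ^ 2 * q + 4 * B * p * q ^ 2 + C * (q : ℤ) ^ 3 = 0 := by
    exact_mod_cast h'
  have hC2 : ¬ (2 : ℤ) ∣ C := fun h ↦ (Int.not_even_iff_odd.mpr hC) (even_iff_two_dvd.mpr h)
  -- `q` is even
  have h2q : (2 : ℤ) ∣ (q : ℤ) := by
    have h4 : (2 : ℤ) ∣ C * (q : ℤ) ^ 3 :=
      ⟨-(2 * p ^ 3 + 2 * A * p ^ 2 * q + 2 * B * p * q ^ 2), by linear_combination hZ⟩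
    rcases Int.prime_two.dvd_or_dvd h4 with h | h
    · exact absurd h hC2
    · exact Int.prime_two.dvd_of_dvd_pow h
  obtain ⟨q', hq'⟩ := h2q
  -- hence `p` is even
  have h2p : (2 : ℤ) ∣ p := by
    rw [hq'] at hZ
    have h8 : (4 : ℤ) * (p ^ 3 + 2 * (A * p ^ 2 * q' + 2 * B * p * q' ^ 2 + C * q' ^ 3)) = 0 := by
      linear_combination hZ
    have h8' := (mul_eq_zero.mp h8).resolve_left (by norm_num)
    exact Int.prime_two.dvd_of_dvd_pow (n := 3)
      ⟨-(A * p ^ 2 * q' + 2 * B * p * q' ^ 2 + C * q' ^ 3), by linear_combination h8'⟩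
  -- contradiction with `gcd(p, q) = 1`
  have hcop : p.natAbs.Coprime q := x.reduced
  have hg : 2 ∣ Nat.gcd p.natAbs q :=
    Nat.dvd_gcd (Int.natCast_dvd.mp h2p) (Int.natCast_dvd_natCast.mp ⟨q', hq'⟩)
  rw [hcop] at hg
  exact absurd hg (by norm_num)

variable (W : WeierstrassCurve ℚ)

/-- **A model `y² + a₃y = x³ + a₂x² + a₄x + a₆` with `a₂, a₄, a₆ ∈ ℤ` and `a₃` an odd integer has
no rational point of order `2`**: its `2`-division cubic is `4x³ + 4a₂x² + 4a₄x + (a₃² + 4a₆)`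
with odd constant term (`cubic_ne_zero_of_odd`). (Equivalently `ψ₂² ≡ 1 (mod 2)` identically, so
no non-zero point of `E[2]` is even defined over `ℚ₂`.) This covers e.g. Cremona's reduced models
of `27a` and the class-number-one CM curves `cm11, cm19, cm43, cm67, cm163` of the tree.
[folklore] -/
private theorem twoTorsionCubic_ne_zero_of_odd_a₃ (h₁ : W.a₁ = 0) (h₂ : ∃ n : ℤ, W.a₂ = n)
    (h₃ : ∃ n : ℤ, W.a₃ = n ∧ Odd n) (h₄ : ∃ n : ℤ, W.a₄ = n) (h₆ : ∃ n : ℤ, W.a₆ = n) (x : ℚ) :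
    4 * x ^ 3 + W.b₂ * x ^ 2 + 2 * W.b₄ * x + W.b₆ ≠ 0 := by
  obtain ⟨A, hA⟩ := h₂
  obtain ⟨c, hc, hodd⟩ := h₃
  obtain ⟨B, hB⟩ := h₄
  obtain ⟨D, hD⟩ := h₆
  have hodd' : Odd (c ^ 2 + 4 * D) := by
    rw [show (4 : ℤ) * D = 2 * (2 * D) by ring]
    exact hodd.pow.add_even (even_two_mul _)
  intro hx
  apply cubic_ne_zero_of_odd A B (c ^ 2 + 4 * D) hodd' x
  rw [b₂, b₄, b₆, h₁, hA, hc, hB, hD] at hx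
  push_cast
  linear_combination hx

/-- Hence **`E(ℚ)[2] = 0`** for such a model. [folklore]
[cite: SilvermanAEC2009, III.2.3 and Exercise 3.7(b)] -/
theorem ratTwoTorsionCard_eq_one_of_odd_a₃ (h₁ : W.a₁ = 0) (h₂ : ∃ n : ℤ, W.a₂ = n)
    (h₃ : ∃ n : ℤ, W.a₃ = n ∧ Odd n) (h₄ : ∃ n : ℤ, W.a₄ = n) (h₆ : ∃ n : ℤ, W.a₆ = n) :
    ratTwoTorsionCard W = 1 :=
  ratTwoTorsionCard_eq_one_of_forall_not_isRoot W fun x hx ↦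
    twoTorsionCubic_ne_zero_of_odd_a₃ W h₁ h₂ h₃ h₄ h₆ x
      ((isRoot_twoTorsionPolynomial_iff W x).mp hx)

/-- … and such an (elliptic) model satisfies [Smi22a] Assumption 1.1 (1), so **Smith's law holds
for it by [Smi22a] Thm. 1.2** (refereed part I only).
[cite: Smith2022SelmerTwistI, Thm. 1.2 with Assumption 1.1 (1)] -/
theorem smith_selmerCorank_density_of_odd_a₃ (h22 : smith2022_selmerCorank_distribution)
    [W.IsElliptic] (h₁ : W.a₁ = 0) (h₂ : ∃ n : ℤ, W.a₂ = n) (h₃ : ∃ n : ℤ, W.a₃ = n ∧ Odd n)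
    (h₄ : ∃ n : ℤ, W.a₄ = n) (h₆ : ∃ n : ℤ, W.a₆ = n) : smith_selmerCorank_density W :=
  smith_selmerCorank_density_of_ratTwoTorsionCard_eq_one W h22
    (ratTwoTorsionCard_eq_one_of_odd_a₃ W h₁ h₂ h₃ h₄ h₆)

/-- `Δ(y² = x³ + k) = -432k²`, so `y² = x³ + k` is elliptic iff `k ≠ 0`.
[cite: SilvermanAEC2009, III.1 (formulas for `b₂, …, Δ`)] -/
theorem isElliptic_of_j_zero_model {k : ℚ} (hk : k ≠ 0) :
    (⟨0, 0, 0, 0, k⟩ : WeierstrassCurve ℚ).IsElliptic := by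
  refine ⟨isUnit_iff_ne_zero.mpr ?_⟩
  have e : (⟨0, 0, 0, 0, k⟩ : WeierstrassCurve ℚ).Δ = -432 * k ^ 2 := by
    simp only [WeierstrassCurve.Δ, WeierstrassCurve.b₂, WeierstrassCurve.b₄, WeierstrassCurve.b₆,
      WeierstrassCurve.b₈]
    ring
  rw [e]
  exact mul_ne_zero (by norm_num) (pow_ne_zero 2 hk)

/-- **The `j = 0` curves `y² = x³ + k` (`k ≠ 0`): `E(ℚ)[2] = 0` iff `-k` is not a rational cube**
(the `2`-division cubic is `4(x³ + k)`). For such `k` the curve satisfies [Smi22a]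
Assumption 1.1 (1). [cite: SilvermanTate2015, §2.1, Thm. 2.1(a)] -/
theorem ratTwoTorsionCard_j_zero_model_eq_one_iff {k : ℚ} (hk : k ≠ 0) :
    ratTwoTorsionCard (⟨0, 0, 0, 0, k⟩ : WeierstrassCurve ℚ) = 1 ↔ ∀ x : ℚ, x ^ 3 + k ≠ 0 := by
  haveI := isElliptic_of_j_zero_model hk
  rw [ratTwoTorsionCard_eq_one_iff_of_a₁_a₃ _ rfl rfl]
  refine forall_congr' fun x ↦ ?_
  rw [show (⟨0, 0, 0, 0, k⟩ : WeierstrassCurve ℚ).a₂ = 0 from rfl,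
    show (⟨0, 0, 0, 0, k⟩ : WeierstrassCurve ℚ).a₄ = 0 from rfl,
    show (⟨0, 0, 0, 0, k⟩ : WeierstrassCurve ℚ).a₆ = k from rfl]
  ring_nf

/-- **Smith's law for `y² = x³ + k` with `-k ∉ ℚ³`** from [Smi22a] Thm. 1.2 (branch (1)); e.g.
the models `y² = x³ + 16` of `27a3 : y² + y = x³` and `y² = x³ - 432` of `27a1 : y² + y = x³ - 7`
(twists with CM by `ℚ(√-3)`, `2` inert). [cite: Smith2022SelmerTwistI, Thm. 1.2 with Assumption 1.1 (1)] -/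
theorem smith_selmerCorank_density_j_zero_model (h22 : smith2022_selmerCorank_distribution)
    {k : ℚ} (hk : k ≠ 0) (h : ∀ x : ℚ, x ^ 3 + k ≠ 0) :
    smith_selmerCorank_density (⟨0, 0, 0, 0, k⟩ : WeierstrassCurve ℚ) :=
  haveI := isElliptic_of_j_zero_model hk
  smith_selmerCorank_density_of_ratTwoTorsionCard_eq_one _ h22
    ((ratTwoTorsionCard_j_zero_model_eq_one_iff hk).mpr h)

end Integral

/-! ## §5 The class-number-one CM curves with `2` inert: `cm11`, `cm19`, `cm43`, `cm67`, `cm163` -/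

section CMCurves

/-- `E₁₁ = cm11 : y² + y = x³ - x² - 7x + 10` (`121b1`, CM by `ℤ[(1 + √-11)/2]`) has
`E(ℚ)[2] = 0` (`a₁ = 0`, `a₃ = 1` odd, integral). [folklore]
[cite: SilvermanATAEC1994, App. A §3 (second table, row D = -11)] -/
theorem ratTwoTorsionCard_cm11 : ratTwoTorsionCard cm11 = 1 :=
  ratTwoTorsionCard_eq_one_of_odd_a₃ cm11 rfl ⟨-1, by norm_num⟩ ⟨1, by norm_num⟩ ⟨-7, by norm_num⟩
    ⟨10, by norm_num⟩

/-- `E₁₉ = cm19 : y² + y = x³ - 38x + 90` (`361a1`) has `E(ℚ)[2] = 0`. [folklore]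
[cite: SilvermanATAEC1994, App. A §3 (second table, row D = -19)] -/
theorem ratTwoTorsionCard_cm19 : ratTwoTorsionCard cm19 = 1 :=
  ratTwoTorsionCard_eq_one_of_odd_a₃ cm19 rfl ⟨0, by norm_num⟩ ⟨1, by norm_num⟩ ⟨-38, by norm_num⟩
    ⟨90, by norm_num⟩

/-- `E₄₃ = cm43 : y² + y = x³ - 860x + 9707` (`1849a1`) has `E(ℚ)[2] = 0`. [folklore]
[cite: SilvermanATAEC1994, App. A §3 (second table, row D = -43)] -/
theorem ratTwoTorsionCard_cm43 : ratTwoTorsionCard cm43 = 1 :=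
  ratTwoTorsionCard_eq_one_of_odd_a₃ cm43 rfl ⟨0, by norm_num⟩ ⟨1, by norm_num⟩
    ⟨-860, by norm_num⟩ ⟨9707, by norm_num⟩

/-- `E₆₇ = cm67 : y² + y = x³ - 7370x + 243528` (`4489a1`) has `E(ℚ)[2] = 0`. [folklore]
[cite: SilvermanATAEC1994, App. A §3 (second table, row D = -67)] -/
theorem ratTwoTorsionCard_cm67 : ratTwoTorsionCard cm67 = 1 :=
  ratTwoTorsionCard_eq_one_of_odd_a₃ cm67 rfl ⟨0, by norm_num⟩ ⟨1, by norm_num⟩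
    ⟨-7370, by norm_num⟩ ⟨243528, by norm_num⟩

/-- `E₁₆₃ = cm163 : y² + y = x³ - 2174420x + 1234136692` (`26569a1`) has `E(ℚ)[2] = 0`.
[folklore] [cite: SilvermanATAEC1994, App. A §3 (second table, row D = -163)] -/
theorem ratTwoTorsionCard_cm163 : ratTwoTorsionCard cm163 = 1 :=
  ratTwoTorsionCard_eq_one_of_odd_a₃ cm163 rfl ⟨0, by norm_num⟩ ⟨1, by norm_num⟩
    ⟨-2174420, by norm_num⟩ ⟨1234136692, by norm_num⟩

/-- **Every elliptic curve over `ℚ` with `j ∈ {-32³, -96³, -960³, -5280³, -640320³}`** — i.e. with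
CM by the maximal order of `ℚ(√-11)`, `ℚ(√-19)`, `ℚ(√-43)`, `ℚ(√-67)`, `ℚ(√-163)` (the
class-number-one fields with `2` inert, other than `ℚ(√-3)`) — **has `E(ℚ)[2] = 0`**:
it is a twist of `cm11`, …, `cm163` up to `ℚ`-isomorphism (`ratTwoTorsionCard_eq_one_of_j_eq`).
[cite: SilvermanATAEC1994, App. A §3 (second table)] [cite: SilvermanAEC2009, X.5 Prop. 5.4] -/
theorem ratTwoTorsionCard_eq_one_of_j_mem (W : WeierstrassCurve ℚ) [W.IsElliptic]
    (hj : W.j = -32768 ∨ W.j = -884736 ∨ W.j = -884736000 ∨ W.j = -147197952000 ∨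
      W.j = -262537412640768000) : ratTwoTorsionCard W = 1 := by
  rcases hj with hj | hj | hj | hj | hj
  · exact ratTwoTorsionCard_eq_one_of_j_eq ratTwoTorsionCard_cm11 (hj.trans j_cm11.symm)
      (by rw [j_cm11]; norm_num) (by rw [j_cm11]; norm_num)
  · exact ratTwoTorsionCard_eq_one_of_j_eq ratTwoTorsionCard_cm19 (hj.trans j_cm19.symm)
      (by rw [j_cm19]; norm_num) (by rw [j_cm19]; norm_num)
  · exact ratTwoTorsionCard_eq_one_of_j_eq ratTwoTorsionCard_cm43 (hj.trans j_cm43.symm)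
      (by rw [j_cm43]; norm_num) (by rw [j_cm43]; norm_num)
  · exact ratTwoTorsionCard_eq_one_of_j_eq ratTwoTorsionCard_cm67 (hj.trans j_cm67.symm)
      (by rw [j_cm67]; norm_num) (by rw [j_cm67]; norm_num)
  · exact ratTwoTorsionCard_eq_one_of_j_eq ratTwoTorsionCard_cm163 (hj.trans j_cm163.symm)
      (by rw [j_cm163]; norm_num) (by rw [j_cm163]; norm_num)

/-- **Smith's `2^∞`-Selmer corank law (tree `smith_selmerCorank_density`) for every elliptic
curve over `ℚ` with CM by `𝒪_K`, `K ∈ {ℚ(√-11), ℚ(√-19), ℚ(√-43), ℚ(√-67), ℚ(√-163)}`, from the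
refereed [Smi22a] = J. Amer. Math. Soc. 39 (2026) 1–72, Thm. 1.2 (branch (1) of Assumption 1.1)
alone** — the `2`-inert companions of the `X₀(49)` statement
`smith_selmerCorank_density_cm7_of_smith2022` (branch (2), which needs part II).
[cite: Smith2022SelmerTwistI, Thm. 1.2 with Assumption 1.1 (1)]
[cite: SilvermanATAEC1994, App. A §3 (second table)] -/
theorem smith_selmerCorank_density_of_j_mem_of_smith2022
    (h22 : smith2022_selmerCorank_distribution) (W : WeierstrassCurve ℚ) [W.IsElliptic]
    (hj : W.j = -32768 ∨ W.j = -884736 ∨ W.j = -884736000 ∨ W.j = -147197952000 ∨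
      W.j = -262537412640768000) : smith_selmerCorank_density W :=
  smith_selmerCorank_density_of_ratTwoTorsionCard_eq_one W h22
    (ratTwoTorsionCard_eq_one_of_j_mem W hj)

/-- In particular for the five minimal models themselves. [cite: Smith2022SelmerTwistI, Thm. 1.2 with Assumption 1.1 (1)] -/
theorem smith_selmerCorank_density_cm_of_smith2022 (h22 : smith2022_selmerCorank_distribution) :
    smith_selmerCorank_density cm11 ∧ smith_selmerCorank_density cm19 ∧
      smith_selmerCorank_density cm43 ∧ smith_selmerCorank_density cm67 ∧
      smith_selmerCorank_density cm163 :=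
  ⟨smith_selmerCorank_density_of_ratTwoTorsionCard_eq_one _ h22 ratTwoTorsionCard_cm11,
    smith_selmerCorank_density_of_ratTwoTorsionCard_eq_one _ h22 ratTwoTorsionCard_cm19,
    smith_selmerCorank_density_of_ratTwoTorsionCard_eq_one _ h22 ratTwoTorsionCard_cm43,
    smith_selmerCorank_density_of_ratTwoTorsionCard_eq_one _ h22 ratTwoTorsionCard_cm67,
    smith_selmerCorank_density_of_ratTwoTorsionCard_eq_one _ h22 ratTwoTorsionCard_cm163⟩

/-- The curves of conductor `27` (CM by orders of `ℚ(√-3)`, `2` inert): Cremona's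
`27a1 : y² + y = x³ - 7` and `27a3 : y² + y = x³` have `E(ℚ)[2] = 0` (`a₃ = 1`).
[cite: Cremona2006, §2 (Cremona labels 27a1, 27a3)] -/
theorem ratTwoTorsionCard_conductor27 :
    ratTwoTorsionCard (⟨0, 0, 1, 0, -7⟩ : WeierstrassCurve ℚ) = 1 ∧
      ratTwoTorsionCard (⟨0, 0, 1, 0, 0⟩ : WeierstrassCurve ℚ) = 1 :=
  ⟨ratTwoTorsionCard_eq_one_of_odd_a₃ _ rfl ⟨0, by norm_num⟩ ⟨1, by norm_num⟩ ⟨0, by norm_num⟩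
      ⟨-7, by norm_num⟩,
    ratTwoTorsionCard_eq_one_of_odd_a₃ _ rfl ⟨0, by norm_num⟩ ⟨1, by norm_num⟩ ⟨0, by norm_num⟩
      ⟨0, by norm_num⟩⟩


/-! ### `j = -12288000` (`D = -27`: CM by `ℤ[3ω] ⊂ ℚ(√-3)`, `2` inert), e.g. `27a4` -/

/-- Cremona's `27a4 : y² + y = x³ - 30x + 63` is elliptic (`Δ = -3⁵`). [cite: Cremona2006, §2 (Cremona label 27a4)] -/
theorem isElliptic_curve27a4 : (⟨0, 0, 1, -30, 63⟩ : WeierstrassCurve ℚ).IsElliptic := by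
  rw [WeierstrassCurve.isElliptic_iff, isUnit_iff_ne_zero]
  norm_num [WeierstrassCurve.Δ, WeierstrassCurve.b₂, WeierstrassCurve.b₄, WeierstrassCurve.b₆,
    WeierstrassCurve.b₈]

/-- `j(27a4) = 1440³/(-243) = -12288000` (row `D = -27` of the table of rational CM
`j`-invariants). [cite: SilvermanATAEC1994, App. A §3 (first table, row D = -27)] -/
theorem j_curve27a4 [(⟨0, 0, 1, -30, 63⟩ : WeierstrassCurve ℚ).IsElliptic] :
    (⟨0, 0, 1, -30, 63⟩ : WeierstrassCurve ℚ).j = -12288000 := by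
  rw [j_eq_c₄_pow_div]
  norm_num [WeierstrassCurve.Δ, WeierstrassCurve.c₄, WeierstrassCurve.b₂, WeierstrassCurve.b₄,
    WeierstrassCurve.b₆, WeierstrassCurve.b₈]

/-- `27a4 : y² + y = x³ - 30x + 63` has `E(ℚ)[2] = 0` (`a₃ = 1`). [folklore]
[cite: SilvermanAEC2009, III.2.3 and Exercise 3.7(b)] -/
theorem ratTwoTorsionCard_curve27a4 :
    ratTwoTorsionCard (⟨0, 0, 1, -30, 63⟩ : WeierstrassCurve ℚ) = 1 :=
  ratTwoTorsionCard_eq_one_of_odd_a₃ _ rfl ⟨0, by norm_num⟩ ⟨1, by norm_num⟩ ⟨-30, by norm_num⟩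
    ⟨63, by norm_num⟩

/-- **Every elliptic curve over `ℚ` with `j = -12288000`** (CM by the order of conductor `3` in
`ℚ(√-3)`) **has `E(ℚ)[2] = 0`** (it is a twist of `27a4` up to `ℚ`-isomorphism).
[cite: SilvermanATAEC1994, App. A §3 (row D = -27)] [cite: SilvermanAEC2009, X.5 Prop. 5.4] -/
theorem ratTwoTorsionCard_eq_one_of_j_eq_neg12288000 (W : WeierstrassCurve ℚ) [W.IsElliptic]
    (hj : W.j = -12288000) : ratTwoTorsionCard W = 1 :=
  haveI := isElliptic_curve27a4
  ratTwoTorsionCard_eq_one_of_j_eq ratTwoTorsionCard_curve27a4 (hj.trans j_curve27a4.symm)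
    (by rw [j_curve27a4]; norm_num) (by rw [j_curve27a4]; norm_num)

/-- **Smith's law for every elliptic curve over `ℚ` with `j = -12288000`, from [Smi22a] Thm. 1.2
(branch (1)) alone.** [cite: Smith2022SelmerTwistI, Thm. 1.2 with Assumption 1.1 (1)] -/
theorem smith_selmerCorank_density_of_j_eq_neg12288000_of_smith2022
    (h22 : smith2022_selmerCorank_distribution) (W : WeierstrassCurve ℚ) [W.IsElliptic]
    (hj : W.j = -12288000) : smith_selmerCorank_density W :=
  smith_selmerCorank_density_of_ratTwoTorsionCard_eq_one W h22
    (ratTwoTorsionCard_eq_one_of_j_eq_neg12288000 W hj)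

end CMCurves

end Literature.NumberTheory.EllipticCurves

end
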